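import Literature.Barriers.Parity.SiegelZeroDichotomyPairHLProp81Weights
import HarnessLib

/-!
# Tao–Teräväinen 2022, §8 (`k = 2`): restricting the `t`-integration — tails of the weight

Topic `Literature/Barriers/Parity`, sub-namespace `TaoTeravainen`; bookkeeping for the two restrictions
of the Fourier variables in the proof of Proposition 8.1 of T. Tao, J. Teräväinen, *The
Hardy–Littlewood–Chowla conjecture in the presence of a Siegel zero*, J. London Math. Soc. (2) 106 (2022),
arXiv:2109.06291, §8: "Using (8.14), (8.15) we see that the contribution of the integral in which the
quantity `|t| := sup |t_{i,j}|` exceeds (say) `log^{1/10} R` is negligible … Using (8.14), (8.15) we see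
that the contribution of the integral in which `|t| ≥ log^{1/10} η` (say) is negligible. Thus we may
restrict attention to the regime (8.21) `|t| ≤ log^{1/(100k)} η`." Everything here is PROVED:

* `setIntegral_pow_mul_norm_psiFourier_tail_le` — `∫_{|τ|>θ} (1+U₀|τ|)^m |ĝ_c| ≤ D_{m+n+2}(1+U₀θ)^{-n} π/U₀`;
* `setIntegral_pow_mul_norm_sieveFourier_tail_le` — `∫_{|τ|>θ} (1+|τ|)^m |f| ≤ C (1+θ)^{-n} π` when
  `(1+|τ|)^{m+n+2}|f| ≤ C`;
* `integral_compl_box_prod_le` — for a product majorant `∏_k a_k(τ_k)` (`a_k ≥ 0` integrable,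
  `∫ a_k ≤ I_k`, `∫_{|τ_k|>θ_k} a_k ≤ J_k`): `∫_{τ ∉ Box(θ)} ∏_k a_k(τ_k) dτ ≤ ∑_k J_k ∏_{k'≠k} I_{k'}`.
  [cite: TaoTeravainen2021, §8 (the two restrictions of `|t|` before (8.21))]
-/

noncomputable section

open Real MeasureTheory Finset Set

namespace Literature.Barriers.Parity

namespace TaoTeravainen

/-! ### One-dimensional tails -/

/-- **Tail moments of `|ĝ_c|`**: `∫_{|τ|>θ} (1+U₀|τ|)^m |ĝ_c(τ)| dτ ≤ D_{m+n+2} (1+U₀θ)^{-n} π/U₀` (`θ ≥ 0`).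
[cite: TaoTeravainen2021, Lemma 8.2 (8.14)] -/
theorem setIntegral_pow_mul_norm_psiFourier_tail_le {φ ψ : ℝ → ℝ} (hφ : IsBump φ) (hψ : IsSmoothCutoff ψ)
    {M : ℕ → ℝ} (hM : ∀ i u, |iteratedDeriv i ψ u| ≤ M i) {X U₀ : ℝ} (hU₀ : 1 ≤ U₀) (hX : 2 * U₀ + 2 ≤ X)
    {c : ℝ} (hc : c ≤ X + 1) (m n : ℕ) {θ : ℝ} (hθ : 0 ≤ θ) :
    ∫ τ in {τ : ℝ | θ < |τ|}, (1 + U₀ * |τ|) ^ m * ‖psiFourier φ ψ X U₀ c τ‖ ≤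
      psiDecayConst M X U₀ (m + n + 2) * ((1 + U₀ * θ) ^ n)⁻¹ * (π / U₀) := by
  have hU₀0 : 0 < U₀ := by linarith
  have hM0 : ∀ i, 0 ≤ M i := fun i => (abs_nonneg _).trans (hM i 0)
  set D := psiDecayConst M X U₀ (m + n + 2) with hD
  have hD0 : 0 ≤ D := psiDecayConst_nonneg hM0 hU₀0.le (by linarith) _
  have hdecay : ∀ τ, (1 + U₀ * |τ|) ^ (m + n + 2) * ‖psiFourier φ ψ X U₀ c τ‖ ≤ D := fun τ => by
    have h := psiFourier_decay hφ hψ hM hU₀ hX hc (m + n + 2) τ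
    rw [hD]; unfold psiDecayConst; exact_mod_cast h
  have hθ1 : 1 ≤ 1 + U₀ * θ := by nlinarith
  set S := {τ : ℝ | θ < |τ|} with hS
  have hSmeas : MeasurableSet S := measurableSet_lt measurable_const measurable_abs
  -- pointwise majorant on `S`: `D (1+U₀θ)^{-n} (1 + (U₀τ)²)⁻¹`
  have hpt : ∀ τ ∈ S, (1 + U₀ * |τ|) ^ m * ‖psiFourier φ ψ X U₀ c τ‖ ≤
      D * ((1 + U₀ * θ) ^ n)⁻¹ * (1 + (U₀ * τ) ^ 2)⁻¹ := by
    intro τ hτ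
    rw [hS, mem_setOf_eq] at hτ
    set w := 1 + U₀ * |τ| with hw
    have hw1 : 1 + U₀ * θ ≤ w := by rw [hw]; gcongr
    have hw0 : 0 < w := by linarith
    have hw2 : 1 + (U₀ * τ) ^ 2 ≤ w ^ 2 := by
      have h0 : 0 ≤ U₀ * |τ| := by positivity
      have : (U₀ * τ) ^ 2 = (U₀ * |τ|) ^ 2 := by rw [mul_pow, mul_pow, sq_abs]
      rw [this, hw]; nlinarith
    have hpos : 0 < 1 + (U₀ * τ) ^ 2 := by positivity
    have hθn : 0 < (1 + U₀ * θ) ^ n := by positivity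
    rw [← div_eq_mul_inv _ (1 + (U₀ * τ) ^ 2), le_div_iff₀ hpos, ← div_eq_mul_inv, le_div_iff₀ hθn]
    calc (1 + U₀ * |τ|) ^ m * ‖psiFourier φ ψ X U₀ c τ‖ * (1 + (U₀ * τ) ^ 2) * (1 + U₀ * θ) ^ n
        ≤ w ^ m * ‖psiFourier φ ψ X U₀ c τ‖ * w ^ 2 * w ^ n := by
          refine mul_le_mul (mul_le_mul_of_nonneg_left hw2 (by positivity)) (pow_le_pow_left₀ (by positivity) hw1 n)
            (by positivity) (by positivity)
      _ = w ^ (m + n + 2) * ‖psiFourier φ ψ X U₀ c τ‖ := by rw [pow_add, pow_add]; ring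
      _ ≤ D := hdecay τ
  have hint := (integral_pow_mul_norm_psiFourier_le hφ hψ hM hU₀ hX hc m).1
  have hmaj : Integrable fun τ : ℝ => D * ((1 + U₀ * θ) ^ n)⁻¹ * (1 + (U₀ * τ) ^ 2)⁻¹ :=
    (integrable_inv_one_add_mul_sq hU₀0.ne').const_mul _
  calc ∫ τ in S, (1 + U₀ * |τ|) ^ m * ‖psiFourier φ ψ X U₀ c τ‖
      ≤ ∫ τ in S, D * ((1 + U₀ * θ) ^ n)⁻¹ * (1 + (U₀ * τ) ^ 2)⁻¹ :=
        setIntegral_mono_on hint.integrableOn hmaj.integrableOn hSmeas hpt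
    _ ≤ ∫ τ, D * ((1 + U₀ * θ) ^ n)⁻¹ * (1 + (U₀ * τ) ^ 2)⁻¹ :=
        setIntegral_le_integral hmaj (Filter.Eventually.of_forall fun τ => by positivity)
    _ = D * ((1 + U₀ * θ) ^ n)⁻¹ * (π / U₀) := by rw [integral_const_mul, integral_inv_one_add_mul_sq hU₀0]

/-- **Tail moments of `|f|`**: if `(1+|τ|)^{m+n+2}|f| ≤ C` then `∫_{|τ|>θ} (1+|τ|)^m |f| ≤ C (1+θ)^{-n} π`
(`θ ≥ 0`). [cite: TaoTeravainen2021, Lemma 8.2 ("`f(t) ≪_A (1+|t|)^{-A}`")] -/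
theorem setIntegral_pow_mul_norm_sieveFourier_tail_le {ψ : ℝ → ℝ} (hψ : IsSmoothCutoff ψ) (m n : ℕ) {C : ℝ}
    (hC : ∀ τ : ℝ, (1 + |τ|) ^ (m + n + 2) * ‖sieveFourier ψ τ‖ ≤ C) {θ : ℝ} (hθ : 0 ≤ θ) :
    ∫ τ in {τ : ℝ | θ < |τ|}, (1 + |τ|) ^ m * ‖sieveFourier ψ τ‖ ≤ C * ((1 + θ) ^ n)⁻¹ * π := by
  have hC0 : 0 ≤ C := le_trans (by positivity) (hC 0)
  set S := {τ : ℝ | θ < |τ|} with hS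
  have hSmeas : MeasurableSet S := measurableSet_lt measurable_const measurable_abs
  have hpt : ∀ τ ∈ S, (1 + |τ|) ^ m * ‖sieveFourier ψ τ‖ ≤ C * ((1 + θ) ^ n)⁻¹ * (1 + (1 * τ) ^ 2)⁻¹ := by
    intro τ hτ
    rw [hS, mem_setOf_eq] at hτ
    set w := 1 + |τ| with hw
    have hw1 : 1 + θ ≤ w := by rw [hw]; linarith
    have hw2 : 1 + (1 * τ) ^ 2 ≤ w ^ 2 := by
      rw [one_mul, ← sq_abs, hw]; have := abs_nonneg τ; nlinarith
    have hpos : 0 < 1 + (1 * τ) ^ 2 := by positivity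
    have hθn : 0 < (1 + θ) ^ n := by positivity
    rw [← div_eq_mul_inv _ (1 + (1 * τ) ^ 2), le_div_iff₀ hpos, ← div_eq_mul_inv, le_div_iff₀ hθn]
    calc (1 + |τ|) ^ m * ‖sieveFourier ψ τ‖ * (1 + (1 * τ) ^ 2) * (1 + θ) ^ n
        ≤ w ^ m * ‖sieveFourier ψ τ‖ * w ^ 2 * w ^ n := by
          refine mul_le_mul (mul_le_mul_of_nonneg_left hw2 (by positivity)) (pow_le_pow_left₀ (by positivity) hw1 n)
            (by positivity) (by positivity)
      _ = w ^ (m + n + 2) * ‖sieveFourier ψ τ‖ := by rw [pow_add, pow_add]; ring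
      _ ≤ C := hC τ
  have hint := integrable_pow_mul_norm_sieveFourier hψ m
  have hmaj : Integrable fun τ : ℝ => C * ((1 + θ) ^ n)⁻¹ * (1 + (1 * τ) ^ 2)⁻¹ :=
    (integrable_inv_one_add_mul_sq one_ne_zero).const_mul _
  calc ∫ τ in S, (1 + |τ|) ^ m * ‖sieveFourier ψ τ‖
      ≤ ∫ τ in S, C * ((1 + θ) ^ n)⁻¹ * (1 + (1 * τ) ^ 2)⁻¹ :=
        setIntegral_mono_on hint.integrableOn hmaj.integrableOn hSmeas hpt
    _ ≤ ∫ τ, C * ((1 + θ) ^ n)⁻¹ * (1 + (1 * τ) ^ 2)⁻¹ :=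
        setIntegral_le_integral hmaj (Filter.Eventually.of_forall fun τ => by positivity)
    _ = C * ((1 + θ) ^ n)⁻¹ * π := by rw [integral_const_mul, integral_inv_one_add_mul_sq one_pos, div_one]

/-! ### The complement of a box, for product majorants -/

/-- **Outside a box, a product majorant integrates to at most `∑_k J_k ∏_{k'≠k} I_{k'}`**: for `a_k ≥ 0`
integrable with `∫ a_k ≤ I_k` and `∫_{|τ|>θ_k} a_k ≤ J_k`,
`∫ 1_{∃ k, |τ_k| > θ_k} ∏_k a_k(τ_k) dτ ≤ ∑_k J_k ∏_{k' ≠ k} I_{k'}`. [folklore] -/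
theorem integral_compl_box_prod_le {ι : Type*} [Fintype ι] [DecidableEq ι] (a : ι → ℝ → ℝ)
    (h0 : ∀ k τ, 0 ≤ a k τ) (hint : ∀ k, Integrable (a k)) {I J : ι → ℝ} (hI : ∀ k, ∫ τ, a k τ ≤ I k)
    (θ : ι → ℝ) (hJ : ∀ k, ∫ τ in {τ : ℝ | θ k < |τ|}, a k τ ≤ J k) :
    ∫ τ : ι → ℝ, {τ : ι → ℝ | ∃ k, θ k < |τ k|}.indicator (fun τ => ∏ k, a k (τ k)) τ ≤
      ∑ k, J k * ∏ k' ∈ univ.erase k, I k' := by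
  have hI0 : ∀ k, 0 ≤ I k := fun k => (integral_nonneg (h0 k)).trans (hI k)
  -- union bound: `1_{∃k} ∏ ≤ ∑_k 1_{|τ_k|>θ_k} ∏`
  set b : ι → (ι → ℝ) → ℝ := fun k τ => ({t : ℝ | θ k < |t|}.indicator (a k) (τ k)) * ∏ k' ∈ univ.erase k, a k' (τ k')
    with hb
  -- each `b k` is a product over slots of one-dimensional nonnegative integrable functions
  have hb_eq : ∀ k τ, b k τ = ∏ k', (if k' = k then {t : ℝ | θ k < |t|}.indicator (a k) else a k') (τ k') := by
    intro k τ
    rw [hb, ← Finset.mul_prod_erase univ _ (mem_univ k)]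
    simp only [if_true]
    congr 1
    refine prod_congr rfl fun k' hk' => ?_
    rw [mem_erase] at hk'; rw [if_neg hk'.1]
  have hak_int : ∀ k, Integrable ({t : ℝ | θ k < |t|}.indicator (a k)) := fun k =>
    (hint k).indicator (measurableSet_lt measurable_const measurable_abs)
  have hb_int_le : ∀ k, Integrable (b k) ∧ ∫ τ, b k τ ≤ J k * ∏ k' ∈ univ.erase k, I k' := by
    intro k
    have h := integral_pi_prod_le_prod (fun k' => if k' = k then {t : ℝ | θ k < |t|}.indicator (a k) else a k')
      (fun k' t => by
        by_cases hk : k' = k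
        · simp only [hk, if_true]; exact Set.indicator_nonneg (fun _ _ => h0 k _) _
        · simp only [hk, if_false]; exact h0 k' t)
      (fun k' => by by_cases hk : k' = k <;> simp only [hk, if_true, if_false] <;> [exact hak_int k; exact hint k'])
      (I := fun k' => if k' = k then J k else I k')
      (fun k' => by
        by_cases hk : k' = k
        · simp only [hk, if_true]; rw [integral_indicator (measurableSet_lt measurable_const measurable_abs)]; exact hJ k
        · simp only [hk, if_false]; exact hI k')
    have hfun : (fun τ : ι → ℝ => ∏ k', (if k' = k then {t : ℝ | θ k < |t|}.indicator (a k) else a k') (τ k')) = b k :=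
      funext fun τ => (hb_eq k τ).symm
    rw [hfun] at h
    refine ⟨h.1, h.2.trans (le_of_eq ?_)⟩
    rw [← Finset.mul_prod_erase univ _ (mem_univ k)]
    simp only [if_true]
    congr 1
    exact prod_congr rfl fun k' hk' => by rw [mem_erase] at hk'; rw [if_neg hk'.1]
  -- pointwise union bound
  have hpt : ∀ τ : ι → ℝ, {τ : ι → ℝ | ∃ k, θ k < |τ k|}.indicator (fun τ => ∏ k, a k (τ k)) τ ≤ ∑ k, b k τ := by
    intro τ
    by_cases hτ : τ ∈ {τ : ι → ℝ | ∃ k, θ k < |τ k|}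
    · rw [Set.indicator_of_mem hτ]
      obtain ⟨k, hk⟩ := hτ
      have hbk : b k τ = ∏ k', a k' (τ k') := by
        rw [hb]; simp only
        rw [Set.indicator_of_mem (show τ k ∈ {t : ℝ | θ k < |t|} from hk), ← Finset.mul_prod_erase univ _ (mem_univ k)]
      rw [← hbk]
      exact Finset.single_le_sum (f := fun k => b k τ) (fun k' _ => by
        rw [hb]; exact mul_nonneg (Set.indicator_nonneg (fun _ _ => h0 _ _) _) (prod_nonneg fun _ _ => h0 _ _)) (mem_univ k)
    · rw [Set.indicator_of_notMem hτ]
      exact Finset.sum_nonneg fun k _ => by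
        rw [hb]; exact mul_nonneg (Set.indicator_nonneg (fun _ _ => h0 _ _) _) (prod_nonneg fun _ _ => h0 _ _)
  have hsum_int : Integrable fun τ : ι → ℝ => ∑ k, b k τ := integrable_finsetSum _ fun k _ => (hb_int_le k).1
  calc ∫ τ : ι → ℝ, {τ : ι → ℝ | ∃ k, θ k < |τ k|}.indicator (fun τ => ∏ k, a k (τ k)) τ
      ≤ ∫ τ : ι → ℝ, ∑ k, b k τ := by
        refine integral_mono_of_nonneg (Filter.Eventually.of_forall fun τ => ?_) hsum_int (Filter.Eventually.of_forall hpt)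
        exact Set.indicator_nonneg (fun _ _ => prod_nonneg fun _ _ => h0 _ _) _
    _ = ∑ k, ∫ τ : ι → ℝ, b k τ := integral_finsetSum _ fun k _ => (hb_int_le k).1
    _ ≤ ∑ k, J k * ∏ k' ∈ univ.erase k, I k' := Finset.sum_le_sum fun k _ => (hb_int_le k).2

end TaoTeravainen

end Literature.Barriers.Parity
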